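import Summits.ValiantsHypothesis.ValiantsHypothesis.Theorems.KPlusLogSqLawWindowDescartes

/-!
# The window Descartes rule — distinct-zero form

Seat val-sym-lift-p4 (g2), cell `pub-symmetroid`, 2026-08-26; sequel of `…WindowDescartes` (GAP-LIFT §7).  THEOREM
(`window_descartes_card_roots`): under the hypotheses of the window Descartes rule (real polynomial `f`, `0 < a < b`,
`p < q`, the monomial of degree `p` dominates `f` at `a` and that of degree `q` dominates at `b`), the number of DISTINCT
ZEROS of `f` in the open window `(a, b)` is at most `V(coeff f p, …, coeff f q)`.  PROOF: interleave the zeros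
`z₁ < … < z_m` of `f` in the window with the midpoints `t₀ < z₁ < t₁ < … < z_m < t_m` (non-zeros) and apply the sign-change
form `window_descartes_sgnChanges` to the two perturbations `f ∓ ε X^p`, `ε > 0` small (same hypotheses with the slack of
the two strict inequalities, same coefficient sign pattern): at the `z_i` their values are `∓ ε z_i^p`, at the `t_i` both
keep the sign of `f`, so the two value lists together change sign at least `2m` times (`weave_count`), whence `2m ≤ 2V`.
HONEST FRAMING: a theorem about real polynomials; nothing here asserts `WeakLifting`, `TropicalB`, Conjecture B,
`MatrixDescartes` (stmt-ValiantsHypothesis-18050) or anything on VP ≠ VNP. [this file's theorem]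
-/

set_option linter.dupNamespace false
set_option autoImplicit false

namespace Summit.ValiantsHypothesis.ValiantsHypothesis.Theorems.KPlusLogSqLaw.WindowDescartes

open Polynomial

section Window

variable {a b : ℝ}

/-! ### The distinct-zero form

`#{x ∈ (a,b) : f x = 0} ≤ V(coeff f p, …, coeff f q)`: interleave the zeros `z₁ < … < z_m` of `f` in the window with the
midpoints `t₀ < z₁ < t₁ < … < z_m < t_m` (non-zeros of `f`) and apply the sign-change form to the two perturbations
`f ∓ ε X^p` (`ε > 0` small: same hypotheses, same coefficient sign pattern): at the `z_i` their values are `∓ ε z_i^p`, at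
the `t_i` both keep the sign of `f`, so the two value lists together change sign at least `2m` times. -/

/-- **interleaving count.**  Abstract form: `F u zs` is the list «separator, z₁, separator, z₂, …, z_m, separator» and
`S u zs` its list of separators (both given through their recursion equations); if `g₁ < 0 < g₂` at the points `z_i` and
`g₁, g₂` are non-zero of equal sign at the separators, then the two value lists have at least `2m` sign changes in total. -/
theorem weave_count (g₁ g₂ : ℝ → ℝ) (F S : ℝ → List ℝ → List ℝ) (sep : ℝ → List ℝ → ℝ)
    (hF0 : ∀ u, F u [] = [sep u []]) (hF1 : ∀ u z rest, F u (z :: rest) = sep u (z :: rest) :: z :: F z rest)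
    (hS0 : ∀ u, S u [] = [sep u []]) (hS1 : ∀ u z rest, S u (z :: rest) = sep u (z :: rest) :: S z rest) :
    ∀ (zs : List ℝ) (u : ℝ), (∀ z ∈ zs, g₁ z < 0 ∧ 0 < g₂ z) →
      (∀ t ∈ S u zs, g₁ t ≠ 0 ∧ SignType.sign (g₁ t) = SignType.sign (g₂ t)) →
      2 * zs.length ≤ sgnChanges ((F u zs).map g₁) + sgnChanges ((F u zs).map g₂) := by
  intro zs
  induction zs with
  | nil => intro u _ _; simp
  | cons z rest ih =>
    intro u hz hS
    have hz1 : g₁ z < 0 := (hz z List.mem_cons_self).1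
    have hz2 : 0 < g₂ z := (hz z List.mem_cons_self).2
    have hSt := hS (sep u (z :: rest)) (by rw [hS1]; exact List.mem_cons_self)
    have hS' : ∀ t ∈ S z rest, g₁ t ≠ 0 ∧ SignType.sign (g₁ t) = SignType.sign (g₂ t) :=
      fun t ht => hS t (by rw [hS1]; exact List.mem_cons_of_mem _ ht)
    have ih' := ih z (fun w hw => hz w (List.mem_cons_of_mem _ hw)) hS'
    -- the head of `F z rest` is the separator `sep z rest`
    set t' := sep z rest with ht'
    have hSt' := hS' t' (by rcases rest with _ | ⟨w, rest'⟩ <;> simp [hS0, hS1, ht'])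
    have hhead : ∀ g : ℝ → ℝ, g t' ≠ 0 → firstNZ ((F z rest).map g) = g t' := by
      intro g hg
      rcases rest with _ | ⟨w, rest'⟩
      · rw [hF0, List.map_cons, List.map_nil, firstNZ_cons_of_ne_zero hg]
      · rw [hF1, List.map_cons, firstNZ_cons_of_ne_zero hg]
    have hg2t' : g₂ t' ≠ 0 := fun h0 => by
      have := hSt'.2; rw [h0, sign_zero, sign_eq_zero_iff] at this; exact hSt'.1 this
    have hg2t : g₂ (sep u (z :: rest)) ≠ 0 := fun h0 => by
      have := hSt.2; rw [h0, sign_zero, sign_eq_zero_iff] at this; exact hSt.1 this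
    rw [hF1, List.map_cons, List.map_cons, List.map_cons, List.map_cons, sgnChanges_cons, sgnChanges_cons,
      sgnChanges_cons, sgnChanges_cons, firstNZ_cons_of_ne_zero hz1.ne, firstNZ_cons_of_ne_zero hz2.ne',
      hhead g₁ hSt'.1, hhead g₂ hg2t', List.length_cons]
    -- the four indicator terms sum to `2`
    set t := sep u (z :: rest)
    have key : (if g₁ z * g₁ t' < 0 then 1 else 0) + (if g₁ t * g₁ z < 0 then 1 else 0)
        + (if g₂ z * g₂ t' < 0 then 1 else 0) + (if g₂ t * g₂ z < 0 then 1 else 0) = 2 := by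
      have s1 := hSt'.2
      have s2 := hSt.2
      -- case on the signs of `g₁ t'` and `g₁ t`
      rcases hSt'.1.lt_or_gt with h1 | h1 <;> rcases hSt.1.lt_or_gt with h2 | h2
      · have h1' : g₂ t' < 0 := by rw [← sign_eq_neg_one_iff, ← s1, sign_eq_neg_one_iff]; exact h1
        have h2' : g₂ t < 0 := by rw [← sign_eq_neg_one_iff, ← s2, sign_eq_neg_one_iff]; exact h2
        rw [if_neg (not_lt.mpr (mul_nonneg_of_nonpos_of_nonpos hz1.le h1.le)), if_neg (not_lt.mpr (mul_nonneg_of_nonpos_of_nonpos h2.le hz1.le)),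
          if_pos (mul_neg_of_pos_of_neg hz2 h1'), if_pos (mul_neg_of_neg_of_pos h2' hz2)]
      · have h1' : g₂ t' < 0 := by rw [← sign_eq_neg_one_iff, ← s1, sign_eq_neg_one_iff]; exact h1
        have h2' : 0 < g₂ t := by rw [← sign_eq_one_iff, ← s2, sign_eq_one_iff]; exact h2
        rw [if_neg (not_lt.mpr (mul_nonneg_of_nonpos_of_nonpos hz1.le h1.le)), if_pos (mul_neg_of_pos_of_neg h2 hz1),
          if_pos (mul_neg_of_pos_of_neg hz2 h1'), if_neg (not_lt.mpr (mul_pos h2' hz2).le)]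
      · have h1' : 0 < g₂ t' := by rw [← sign_eq_one_iff, ← s1, sign_eq_one_iff]; exact h1
        have h2' : g₂ t < 0 := by rw [← sign_eq_neg_one_iff, ← s2, sign_eq_neg_one_iff]; exact h2
        rw [if_pos (mul_neg_of_neg_of_pos hz1 h1), if_neg (not_lt.mpr (mul_nonneg_of_nonpos_of_nonpos h2.le hz1.le)),
          if_neg (not_lt.mpr (mul_pos hz2 h1').le), if_pos (mul_neg_of_neg_of_pos h2' hz2)]
      · have h1' : 0 < g₂ t' := by rw [← sign_eq_one_iff, ← s1, sign_eq_one_iff]; exact h1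
        have h2' : 0 < g₂ t := by rw [← sign_eq_one_iff, ← s2, sign_eq_one_iff]; exact h2
        rw [if_pos (mul_neg_of_neg_of_pos hz1 h1), if_pos (mul_neg_of_pos_of_neg h2 hz1),
          if_neg (not_lt.mpr (mul_pos hz2 h1').le), if_neg (not_lt.mpr (mul_pos h2' hz2).le)]
    omega

/-- **The window Descartes rule (distinct-zero form).**  Under the hypotheses of `window_descartes_sgnChanges`, the number of
distinct zeros of `f` in the open window `(a, b)` is at most the number of sign changes of the coefficient block
`coeff f p, …, coeff f q`. -/
theorem window_descartes_card_roots (f : ℝ[X]) {N : ℕ} (hN : f.natDegree ≤ N) (ha : 0 < a) (hab : a < b)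
    {p q : ℕ} (hpq : p < q)
    (hda : ∑ s ∈ (Finset.range (N + 1)).erase p, |f.coeff s| * a ^ s < |f.coeff p| * a ^ p)
    (hdb : ∑ s ∈ (Finset.range (N + 1)).erase q, |f.coeff s| * b ^ s < |f.coeff q| * b ^ q) :
    ((f.roots.toFinset).filter (fun x => a < x ∧ x < b)).card ≤ sgnChanges (slist (fun i => f.coeff (p + i)) (q - p)) := by
  have hb : 0 < b := ha.trans hab
  -- the two dominant coefficients are non-zero; the slacks of the two strict inequalities
  have hcp : f.coeff p ≠ 0 := by
    intro h0; rw [h0, abs_zero, zero_mul] at hda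
    exact absurd hda (not_lt.mpr (Finset.sum_nonneg fun s _ => mul_nonneg (abs_nonneg _) (pow_nonneg ha.le _)))
  have hpN : p ≤ N := (le_natDegree_of_ne_zero hcp).trans hN
  have hf0 : f ≠ 0 := fun h => hcp (by rw [h, coeff_zero])
  -- the zeros in the window, sorted
  set Z := (f.roots.toFinset).filter (fun x => a < x ∧ x < b) with hZ
  set zs := Z.sort (· ≤ ·) with hzs
  have hzs_sorted : zs.Pairwise (· < ·) := (Finset.sortedLT_sort Z).pairwise
  have hmemZ : ∀ z, z ∈ zs ↔ (f.IsRoot z ∧ a < z ∧ z < b) := fun z => by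
    rw [hzs, Finset.mem_sort, hZ, Finset.mem_filter, Multiset.mem_toFinset, mem_roots hf0]
  have hlen : zs.length = Z.card := Finset.length_sort _
  -- the interleaved point list and its separators
  let sep : ℝ → List ℝ → ℝ := fun u zs => (u + zs.headD b) / 2
  let S : ℝ → List ℝ → List ℝ := fun u zs => List.zipWith (fun v w => (v + w) / 2) (u :: zs) (zs ++ [b])
  let F : ℝ → List ℝ → List ℝ := fun u zs =>
    (List.zipWith (fun v z => [(v + z) / 2, z]) (u :: zs) zs).flatten ++ [((u :: zs).getLast (List.cons_ne_nil _ _) + b) / 2]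
  have hF0 : ∀ u, F u [] = [sep u []] := fun u => by simp [F, sep]
  have hF1 : ∀ u z rest, F u (z :: rest) = sep u (z :: rest) :: z :: F z rest := fun u z rest => by
    simp [F, sep]
  have hS0 : ∀ u, S u [] = [sep u []] := fun u => by simp [S, sep]
  have hS1 : ∀ u z rest, S u (z :: rest) = sep u (z :: rest) :: S z rest := fun u z rest => by simp [S, sep]
  -- geometry of the construction
  have geo : ∀ (ws : List ℝ) (u : ℝ), a ≤ u → u < b → ws.Pairwise (· < ·) → (∀ w ∈ ws, u < w ∧ w < b) →
      (∀ r, a < r → r < b → f.IsRoot r → u < r → r ∈ ws) →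
      ((F u ws).Pairwise (· < ·) ∧ (∀ x ∈ F u ws, u < x ∧ x < b) ∧ (∀ t ∈ S u ws, a < t ∧ t < b ∧ ¬ f.IsRoot t)) := by
    intro ws
    induction ws with
    | nil =>
      intro u hau hub _ _ hroots
      have hsep0 : sep u [] = (u + b) / 2 := by simp [sep]
      have h1 : u < (u + b) / 2 := by linarith
      have h2 : (u + b) / 2 < b := by linarith
      refine ⟨by rw [hF0]; exact List.pairwise_singleton _ _, fun x hx => ?_, fun t ht => ?_⟩
      · rw [hF0, List.mem_singleton, hsep0] at hx; subst hx; exact ⟨h1, h2⟩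
      · rw [hS0, List.mem_singleton, hsep0] at ht; subst ht
        exact ⟨by linarith, h2, fun hr => by simpa using hroots _ (by linarith) h2 hr h1⟩
    | cons z rest ih =>
      intro u hau hub hsort hwin hroots
      have huz : u < z := (hwin z List.mem_cons_self).1
      have hzb : z < b := (hwin z List.mem_cons_self).2
      have hrest : ∀ w ∈ rest, z < w ∧ w < b := fun w hw =>
        ⟨List.rel_of_pairwise_cons hsort hw, (hwin w (List.mem_cons_of_mem _ hw)).2⟩
      have hroots' : ∀ r, a < r → r < b → f.IsRoot r → z < r → r ∈ rest := by
        intro r har hrb hr hzr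
        have := hroots r har hrb hr (huz.trans hzr)
        rcases List.mem_cons.mp this with rfl | h
        · exact absurd hzr (lt_irrefl _)
        · exact h
      obtain ⟨ih1, ih2, ih3⟩ := ih z (hau.trans huz.le) hzb (List.pairwise_cons.mp hsort).2 hrest hroots'
      have hsep1 : sep u (z :: rest) = (u + z) / 2 := by simp [sep]
      have ht1 : u < (u + z) / 2 := by linarith
      have ht2 : (u + z) / 2 < z := by linarith
      refine ⟨?_, ?_, ?_⟩
      · rw [hF1, hsep1]
        refine List.pairwise_cons.mpr ⟨fun x hx => ?_, List.pairwise_cons.mpr ⟨fun x hx => (ih2 x hx).1, ih1⟩⟩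
        rcases List.mem_cons.mp hx with rfl | hx
        · exact ht2
        · exact ht2.trans (ih2 x hx).1
      · intro x hx
        rw [hF1, hsep1] at hx
        rcases List.mem_cons.mp hx with rfl | hx
        · exact ⟨ht1, by linarith⟩
        rcases List.mem_cons.mp hx with rfl | hx
        · exact ⟨huz, hzb⟩
        · exact ⟨huz.trans (ih2 x hx).1, (ih2 x hx).2⟩
      · intro t ht
        rw [hS1, hsep1] at ht
        rcases List.mem_cons.mp ht with rfl | ht
        · refine ⟨by linarith, by linarith, fun hr => ?_⟩
          have hmem := hroots _ (by linarith) (by linarith) hr (by linarith)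
          rcases List.mem_cons.mp hmem with h | h
          · linarith
          · have := (hrest _ h).1; linarith
        · exact ih3 t ht
  obtain ⟨gsort, gwin, gsep⟩ := geo zs a le_rfl hab hzs_sorted
    (fun w hw => ⟨((hmemZ w).mp hw).2.1, ((hmemZ w).mp hw).2.2⟩)
    (fun r har hrb hr _ => (hmemZ r).mpr ⟨hr, har, hrb⟩)
  -- choice of ε
  have hμ : ∃ μ : ℝ, 0 < μ ∧ ∀ t ∈ S a zs, μ ≤ |f.eval t| := by
    have gen : ∀ l : List ℝ, (∀ t ∈ l, ¬ f.IsRoot t) → ∃ μ : ℝ, 0 < μ ∧ ∀ t ∈ l, μ ≤ |f.eval t| := by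
      intro l
      induction l with
      | nil => intro _; exact ⟨1, one_pos, fun t ht => absurd ht List.not_mem_nil⟩
      | cons y l ihl =>
        intro hl
        obtain ⟨μ, hμ0, hμl⟩ := ihl (fun t ht => hl t (List.mem_cons_of_mem _ ht))
        have hy : 0 < |f.eval y| := abs_pos.mpr (hl y List.mem_cons_self)
        refine ⟨min μ |f.eval y|, lt_min hμ0 hy, fun t ht => ?_⟩
        rcases List.mem_cons.mp ht with rfl | ht
        · exact min_le_right _ _
        · exact (min_le_left _ _).trans (hμl t ht)
    exact gen (S a zs) (fun t ht => (gsep t ht).2.2)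
  obtain ⟨μ, hμ0, hμS⟩ := hμ
  set slackA := |f.coeff p| * a ^ p - ∑ s ∈ (Finset.range (N + 1)).erase p, |f.coeff s| * a ^ s with hslackA
  set slackB := |f.coeff q| * b ^ q - ∑ s ∈ (Finset.range (N + 1)).erase q, |f.coeff s| * b ^ s with hslackB
  have hslackA0 : 0 < slackA := by rw [hslackA]; linarith
  have hslackB0 : 0 < slackB := by rw [hslackB]; linarith
  have hap : 0 < a ^ p := pow_pos ha p
  have hbp : 0 < b ^ p := pow_pos hb p
  set ε := min (min (slackA / (2 * a ^ p)) (slackB / (2 * b ^ p))) (min (|f.coeff p| / 2) (μ / (2 * b ^ p))) with hε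
  have hε0 : 0 < ε := lt_min (lt_min (div_pos hslackA0 (by linarith)) (div_pos hslackB0 (by linarith)))
    (lt_min (half_pos (abs_pos.mpr hcp)) (div_pos hμ0 (by linarith)))
  have hR1 : ε * a ^ p < slackA := by
    have h1 : ε ≤ slackA / (2 * a ^ p) := (min_le_left _ _).trans (min_le_left _ _)
    have h2 : slackA / (2 * a ^ p) * a ^ p = slackA / 2 := by field_simp
    nlinarith
  have hR2 : ε * b ^ p < slackB := by
    have h1 : ε ≤ slackB / (2 * b ^ p) := (min_le_left _ _).trans (min_le_right _ _)
    have h2 : slackB / (2 * b ^ p) * b ^ p = slackB / 2 := by field_simp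
    nlinarith
  have hR3 : ε < |f.coeff p| := by
    have h1 : ε ≤ |f.coeff p| / 2 := (min_le_right _ _).trans (min_le_left _ _)
    linarith [abs_pos.mpr hcp]
  have hR4 : ε * b ^ p < μ := by
    have h1 : ε ≤ μ / (2 * b ^ p) := (min_le_right _ _).trans (min_le_right _ _)
    have h2 : μ / (2 * b ^ p) * b ^ p = μ / 2 := by field_simp
    nlinarith
  -- the perturbations `g κ = f + κ X^p`, `|κ| = ε`
  let g : ℝ → ℝ[X] := fun κ => f + Polynomial.C κ * Polynomial.X ^ p
  have hg_coeff : ∀ κ s, (g κ).coeff s = f.coeff s + if s = p then κ else 0 := fun κ s => by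
    simp only [g, coeff_add, coeff_C_mul_X_pow]
  have hg_eval : ∀ κ x, (g κ).eval x = f.eval x + κ * x ^ p := fun κ x => by
    simp only [g, eval_add, eval_mul, eval_C, eval_pow, eval_X]
  have hg_deg : ∀ κ, (g κ).natDegree ≤ N := fun κ =>
    (natDegree_add_le _ _).trans (max_le hN ((natDegree_C_mul_X_pow_le κ p).trans hpN))
  -- the window rule applies to `g κ` for `|κ| = ε`, with the same bound
  have hA : ∀ κ, |κ| = ε →
      sgnChanges ((F a zs).map fun x => (g κ).eval x) ≤ sgnChanges (slist (fun i => f.coeff (p + i)) (q - p)) := by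
    intro κ hκ
    have hκp : |κ| < |f.coeff p| := hκ ▸ hR3
    have hda' : ∑ s ∈ (Finset.range (N + 1)).erase p, |(g κ).coeff s| * a ^ s < |(g κ).coeff p| * a ^ p := by
      have e1 : ∑ s ∈ (Finset.range (N + 1)).erase p, |(g κ).coeff s| * a ^ s
          = ∑ s ∈ (Finset.range (N + 1)).erase p, |f.coeff s| * a ^ s :=
        Finset.sum_congr rfl fun s hs => by rw [hg_coeff, if_neg (Finset.ne_of_mem_erase hs), add_zero]
      have e2 : |f.coeff p| - ε ≤ |(g κ).coeff p| := by
        rw [hg_coeff, if_pos rfl, ← hκ]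
        have := abs_sub_abs_le_abs_sub (f.coeff p) (-κ)
        rw [abs_neg, sub_neg_eq_add] at this
        exact this
      rw [e1]
      nlinarith [hR1, hap]
    have hdb' : ∑ s ∈ (Finset.range (N + 1)).erase q, |(g κ).coeff s| * b ^ s < |(g κ).coeff q| * b ^ q := by
      have hpmem : p ∈ (Finset.range (N + 1)).erase q := by
        rw [Finset.mem_erase, Finset.mem_range]; exact ⟨hpq.ne, by omega⟩
      have e1 : ∑ s ∈ (Finset.range (N + 1)).erase q, |(g κ).coeff s| * b ^ s
          ≤ ∑ s ∈ (Finset.range (N + 1)).erase q, (|f.coeff s| * b ^ s + if s = p then ε * b ^ p else 0) := by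
        refine Finset.sum_le_sum fun s _ => ?_
        rw [hg_coeff]
        by_cases hsp : s = p
        · subst hsp; rw [if_pos rfl, if_pos rfl, ← hκ]
          nlinarith [abs_add_le (f.coeff s) κ, hbp]
        · rw [if_neg hsp, if_neg hsp, add_zero, add_zero]
      rw [Finset.sum_add_distrib, Finset.sum_ite_eq' _ p, if_pos hpmem] at e1
      have e2 : (g κ).coeff q = f.coeff q := by rw [hg_coeff, if_neg hpq.ne', add_zero]
      rw [e2]
      linarith [hR2]
    have hV : sgnChanges (slist (fun i => (g κ).coeff (p + i)) (q - p)) = sgnChanges (slist (fun i => f.coeff (p + i)) (q - p)) := by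
      refine sgnChanges_slist_congr_sign fun i _ => ?_
      rw [hg_coeff]
      by_cases hi : i = 0
      · subst hi; rw [Nat.add_zero, if_pos rfl]; exact sign_add_eq_sign_of_abs_lt hκp
      · rw [if_neg (by omega), add_zero]
    rw [← hV]
    exact window_descartes_sgnChanges (g κ) (hg_deg κ) ha hab hpq hda' hdb' (F a zs) gsort
      (fun x hx => (gwin x hx).1) (fun x hx => (gwin x hx).2)
  -- values of the two perturbations at the zeros and at the separators
  have hvalZ : ∀ z ∈ zs, (g (-ε)).eval z < 0 ∧ 0 < (g ε).eval z := by
    intro z hz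
    obtain ⟨hr, haz, _⟩ := (hmemZ z).mp hz
    have hz0 : 0 < z ^ p := pow_pos (ha.trans haz) p
    rw [hg_eval, hg_eval, hr.eq_zero, zero_add, zero_add]
    exact ⟨by nlinarith, by nlinarith⟩
  have hvalS : ∀ t ∈ S a zs, (g (-ε)).eval t ≠ 0 ∧ SignType.sign ((g (-ε)).eval t) = SignType.sign ((g ε).eval t) := by
    intro t ht
    obtain ⟨hat, htb, hroot⟩ := gsep t ht
    have ht0 : 0 < t := ha.trans hat
    have htp : t ^ p ≤ b ^ p := pow_le_pow_left₀ ht0.le htb.le p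
    have hsmall : |ε * t ^ p| < |f.eval t| := by
      rw [abs_of_nonneg (mul_nonneg hε0.le (pow_nonneg ht0.le _))]
      calc ε * t ^ p ≤ ε * b ^ p := mul_le_mul_of_nonneg_left htp hε0.le
        _ < μ := hR4
        _ ≤ |f.eval t| := hμS t ht
    have s1 : SignType.sign ((g (-ε)).eval t) = SignType.sign (f.eval t) := by
      rw [hg_eval, show f.eval t + -ε * t ^ p = f.eval t + -(ε * t ^ p) by ring]
      exact sign_add_eq_sign_of_abs_lt (by rwa [abs_neg])
    have s2 : SignType.sign ((g ε).eval t) = SignType.sign (f.eval t) := by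
      rw [hg_eval]; exact sign_add_eq_sign_of_abs_lt hsmall
    refine ⟨fun h0 => hroot ?_, s1.trans s2.symm⟩
    have := s1; rw [h0, sign_zero] at this
    exact sign_eq_zero_iff.mp this.symm
  -- count
  have hcount := weave_count (fun x => (g (-ε)).eval x) (fun x => (g ε).eval x) F S sep hF0 hF1 hS0 hS1 zs a hvalZ hvalS
  have h1 := hA (-ε) (by rw [abs_neg, abs_of_pos hε0])
  have h2 := hA ε (abs_of_pos hε0)
  rw [← hlen]
  omega

end Window

end Summit.ValiantsHypothesis.ValiantsHypothesis.Theorems.KPlusLogSqLaw.WindowDescartes
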